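import Mathlib.MeasureTheory.Integral.IntervalIntegral.FundThmCalculus
import Literature.Analysis.FluidPDE.RadialTestIBP
import HarnessLib

/-!
# The divergence theorem on spherical shells (flux form)

Support file (all results proved) for Bartnik's existence theorem for the ADM energy
(`Literature.Geometry.Lorentzian.AFEnd.HasADMEnergy_of_isAsymptoticallyFlat`), whose proof
compares the ADM fluxes through two coordinate spheres with the integral of a divergence over the
shell between them.

For a `C¹` vector field `V` on a finite-dimensional real inner product space `E` (additive Haar
measure `μ`, polar surface measure `σ = μ.toSphere`, `n = dim E`) and `0 < a ≤ b` we prove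
(`setIntegral_shell_divergence_eq`)

  `∫_{a<‖x‖<b} div V dμ = b^{n-1} ∫ ⟪α, V(bα)⟫ dσ(α) − a^{n-1} ∫ ⟪α, V(aα)⟫ dσ(α)`,

`div V = tr DV`, i.e. Gauss–Green on the shell with the outward/inward unit normals `±x/‖x‖`.
Mathlib has the divergence theorem only on boxes; the proof here avoids surface measure theory:

1. the flux `A(r) = r^{n-1} ∫ ⟪α, V(rα)⟫ dσ` is `C¹` on `(0, ∞)` (differentiation under the
   integral sign, `hasDerivAt_sphereIntegral`) — `exists_hasDerivAt_flux`;
2. for a radial test function `φ(‖·‖)`, `φ ∈ C_c^∞((0, ∞))`, integration by parts on `E`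
   (`integral_radial_mul_divergence`, file `RadialTestIBP`) gives
   `∫ φ(‖x‖) div V = −∫ φ'(‖x‖) ⟪x/‖x‖, V⟫`, i.e. `∫ φ B = −∫ φ' A` in polar coordinates, with
   `B(r) = r^{n-1} ∫ div V(rα) dσ`;
3. du Bois-Reymond's lemma (`eqOn_deriv_of_integral_mul_eq`) yields `A' = B` on `(0, ∞)`;
4. the fundamental theorem of calculus and polar coordinates on the shell conclude.

## References

* L. C. Evans, R. F. Gariepy, *Measure theory and fine properties of functions* (1992), §5.8,
  Thm. 1 (Gauss–Green), here for the smooth domain `{a < ‖x‖ < b}` and `C¹` fields.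
* H. Federer, *Geometric measure theory* (1969), 4.5.6.
-/

noncomputable section

open Set Function Metric Module Filter MeasureTheory MeasureTheory.Measure
open scoped Topology RealInnerProductSpace ContDiff

namespace Literature.Analysis.FluidPDE

variable {E : Type*} [NormedAddCommGroup E] [InnerProductSpace ℝ E] [FiniteDimensional ℝ E]
  [MeasurableSpace E] [BorelSpace E] (μ : Measure E) [μ.IsAddHaarMeasure]

/-! ### The flux through spheres and its derivative -/

/-- **The flux of a `C¹` field through spheres is `C¹` in the radius.** For `V ∈ C¹(E; E)` the
function `A(r) = r^{n-1} ∫ ⟪‖x‖⁻¹ x, V x⟫|_{x = rα} dσ(α)` has a continuous derivative on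
`(0, ∞)` (write `A(r) = r^{n-1} r⁻¹ ∫ ⟪x, V x⟫|_{x = rα} dσ` and differentiate the sphere
integral of the `C¹` function `⟪x, V x⟫` under the integral sign). [folklore] -/
theorem exists_hasDerivAt_flux {V : E → E} (hV : ContDiff ℝ 1 V) :
    ∃ A' : ℝ → ℝ, ContinuousOn A' (Ioi 0) ∧ ∀ r, 0 < r →
      HasDerivAt (fun r ↦ r ^ (finrank ℝ E - 1) *
        sphereIntegral μ (fun x ↦ ⟪‖x‖⁻¹ • x, V x⟫) r) (A' r) r := by
  set n := finrank ℝ E with hn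
  set G : E → ℝ := fun x ↦ ⟪x, V x⟫ with hG
  have hGd : ContDiff ℝ 1 G := contDiff_id.inner ℝ hV
  set T : ℝ → ℝ := sphereIntegral μ G with hT
  set T' : ℝ → ℝ := fun r ↦ ∫ α, fderiv ℝ G (r • (α : E)) (α : E) ∂μ.toSphere with hT'
  have hTd : ∀ r, HasDerivAt T (T' r) r := fun r ↦ hasDerivAt_sphereIntegral μ hGd r
  have hT'c : Continuous T' := by
    have hF : Continuous (uncurry fun (r : ℝ) (α : sphere (0 : E) 1) ↦
        fderiv ℝ G (r • (α : E)) (α : E)) :=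
      ((hGd.continuous_fderiv one_ne_zero).comp
        (continuous_fst.smul (continuous_subtype_val.comp continuous_snd))).clm_apply
        (continuous_subtype_val.comp continuous_snd)
    have h := continuous_parametric_integral_of_continuous (μ := μ.toSphere) hF isCompact_univ
    simp only [Measure.restrict_univ] at h
    exact h
  -- the flux is `p(r) * T(r)` with `p(r) = r^(n-1) r⁻¹` on `(0, ∞)`
  have hS : ∀ r, 0 < r → sphereIntegral μ (fun x ↦ ⟪‖x‖⁻¹ • x, V x⟫) r = r⁻¹ * T r := by
    intro r hr
    have : (fun x : E ↦ ⟪‖x‖⁻¹ • x, V x⟫) = fun x ↦ ‖x‖⁻¹ • G x := by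
      funext x
      simp only [hG, real_inner_smul_left, smul_eq_mul]
    rw [this, sphereIntegral_inv_norm_smul μ hr, smul_eq_mul]
  set p : ℝ → ℝ := fun r ↦ r ^ (n - 1) * r⁻¹ with hp
  set p' : ℝ → ℝ := fun r ↦ ((n - 1 : ℕ) : ℝ) * r ^ (n - 1 - 1) * r⁻¹ + r ^ (n - 1) * (-(r ^ 2)⁻¹)
    with hp'
  have hpd : ∀ r, 0 < r → HasDerivAt p (p' r) r := fun r hr ↦
    (hasDerivAt_pow (n - 1) r).mul (hasDerivAt_inv hr.ne')
  refine ⟨fun r ↦ p' r * T r + p r * T' r, ?_, fun r hr ↦ ?_⟩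
  · refine ContinuousOn.add (ContinuousOn.mul ?_ (fun r _ ↦ (hTd r).continuousAt.continuousWithinAt))
      (ContinuousOn.mul ?_ hT'c.continuousOn)
    · refine ContinuousOn.add ((continuousOn_const.mul (continuousOn_pow _)).mul
        (continuousOn_inv₀.mono fun r hr ↦ (mem_Ioi.1 hr).ne')) ((continuousOn_pow _).mul ?_)
      exact ((continuousOn_pow 2).inv₀ fun r hr ↦ pow_ne_zero 2 (mem_Ioi.1 hr).ne').neg
    · exact (continuousOn_pow _).mul (continuousOn_inv₀.mono fun r hr ↦ (mem_Ioi.1 hr).ne')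
  · have heq : (fun r ↦ r ^ (n - 1) * sphereIntegral μ (fun x ↦ ⟪‖x‖⁻¹ • x, V x⟫) r) =ᶠ[𝓝 r]
        fun r ↦ p r * T r := by
      filter_upwards [Ioi_mem_nhds hr] with s hs
      rw [hS s hs, hp]
      ring
    refine HasDerivAt.congr_of_eventuallyEq ?_ heq
    exact (hpd r hr).mul (hTd r)

/-! ### The divergence theorem on shells -/

/-- **The divergence theorem on a spherical shell, flux form.** Let `V ∈ C¹(E; E)` on a
finite-dimensional real inner product space of dimension `n ≥ 1` with an additive Haar measure
`μ` and polar surface measure `σ = μ.toSphere`, and `0 < a ≤ b`. Then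
`∫_{a<‖x‖<b} tr DV dμ = b^{n-1} ∫ ⟪α, V(bα)⟫ dσ(α) − a^{n-1} ∫ ⟪α, V(aα)⟫ dσ(α)`
(the sphere integrals written as `sphereIntegral μ (x ↦ ⟪‖x‖⁻¹ x, V x⟫)`): the integral of
the divergence over the shell is the outward flux through the outer sphere minus the flux through
the inner sphere. Evans–Gariepy 1992, §5.8, Thm. 1 (Gauss–Green) for this domain; proved here
from flat integration by parts, polar coordinates and the fundamental lemma of the calculus of
variations (see the module docstring). [folklore] -/
theorem setIntegral_shell_divergence_eq [Nontrivial E] {V : E → E} (hV : ContDiff ℝ 1 V)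
    {a b : ℝ} (ha : 0 < a) (hab : a ≤ b) :
    ∫ x in {x : E | a < ‖x‖ ∧ ‖x‖ < b}, LinearMap.trace ℝ E (fderiv ℝ V x : E →ₗ[ℝ] E) ∂μ =
      b ^ (finrank ℝ E - 1) * sphereIntegral μ (fun x ↦ ⟪‖x‖⁻¹ • x, V x⟫) b -
        a ^ (finrank ℝ E - 1) * sphereIntegral μ (fun x ↦ ⟪‖x‖⁻¹ • x, V x⟫) a := by
  set n := finrank ℝ E with hn
  set dV : E → ℝ := fun x ↦ LinearMap.trace ℝ E (fderiv ℝ V x : E →ₗ[ℝ] E) with hdV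
  set A : ℝ → ℝ := fun r ↦ r ^ (n - 1) * sphereIntegral μ (fun x ↦ ⟪‖x‖⁻¹ • x, V x⟫) r with hA
  set B : ℝ → ℝ := fun r ↦ r ^ (n - 1) * sphereIntegral μ dV r with hB
  have hVd : Differentiable ℝ V := hV.differentiable one_ne_zero
  -- continuity of the divergence
  have hdVc : Continuous dV := continuous_trace_fderiv hV
  -- (1) the flux is `C¹` on `(0, ∞)`
  obtain ⟨A', hA'c, hAd⟩ := exists_hasDerivAt_flux μ hV
  -- (2)+(3) `A' = B` on `(0, ∞)`
  have hBc : ContinuousOn B (Ioi 0) :=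
    ((continuous_pow _).mul (continuous_sphereIntegral μ hdVc)).continuousOn
  have hkey : EqOn A' B (Ioi 0) := by
    refine eqOn_deriv_of_integral_mul_eq hAd hA'c hBc fun φ hφ hφc hφs ↦ ?_
    -- both sides in polar coordinates
    obtain ⟨hψ, -⟩ := contDiff_comp_norm_of_tsupport_subset (E := E) hφ hφs
    obtain ⟨R, hR⟩ := hφc.isCompact.isBounded.subset_closedBall 0
    have hrad0 : ∀ (θ : ℝ → ℝ), tsupport θ ⊆ tsupport φ → ∀ x : E, x ∉ closedBall (0 : E) R →
        θ ‖x‖ = 0 := fun θ hθ x hx ↦ by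
      apply image_eq_zero_of_notMem_tsupport
      intro h
      have := hR (hθ h)
      rw [mem_closedBall, dist_zero_right, Real.norm_eq_abs, abs_norm] at this
      exact hx (mem_closedBall.2 (by simpa using this))
    have hc1 : HasCompactSupport fun x : E ↦ φ ‖x‖ :=
      HasCompactSupport.intro (isCompact_closedBall 0 R) (hrad0 φ subset_rfl)
    have hc2 : HasCompactSupport fun x : E ↦ deriv φ ‖x‖ :=
      HasCompactSupport.intro (isCompact_closedBall 0 R) (hrad0 (deriv φ) tsupport_deriv_subset)
    have hi1 : Integrable (fun x : E ↦ φ ‖x‖ * dV x) μ :=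
      ((hφ.continuous.comp continuous_norm).mul hdVc).integrable_of_hasCompactSupport hc1.mul_right
    -- the flux density is continuous away from the origin, and `φ' ∘ ‖·‖` vanishes near it
    have hflux : ContinuousOn (fun x : E ↦ ⟪‖x‖⁻¹ • x, V x⟫) {0}ᶜ := by
      refine ContinuousOn.inner (((continuousOn_inv₀.comp continuous_norm.continuousOn
        fun x hx ↦ ?_).smul continuousOn_id)) hV.continuous.continuousOn
      simpa using hx
    have h0' : deriv φ =ᶠ[𝓝 0] 0 := notMem_tsupport_iff_eventuallyEq.1 fun h ↦
      lt_irrefl _ (mem_Ioi.1 (hφs (tsupport_deriv_subset h)))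
    have hsupp2 : tsupport (fun x : E ↦ deriv φ ‖x‖) ⊆ {0}ᶜ := by
      intro x hx h0
      rw [mem_singleton_iff] at h0
      subst h0
      refine (notMem_tsupport_iff_eventuallyEq.2 ?_) hx
      have := (tendsto_norm_zero (E := E)).eventually h0'
      filter_upwards [this] with x hx
      exact hx
    have hcont2 : Continuous fun x : E ↦ deriv φ ‖x‖ * ⟪‖x‖⁻¹ • x, V x⟫ :=
      continuous_mul_of_tsupport_subset_open isOpen_compl_singleton
        ((hφ.continuous_deriv (by simp)).comp continuous_norm) hsupp2 hflux
    have hi2 : Integrable (fun x : E ↦ deriv φ ‖x‖ * ⟪‖x‖⁻¹ • x, V x⟫) μ :=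
      hcont2.integrable_of_hasCompactSupport hc2.mul_right
    -- test functions vanish off `(0, ∞)`
    have hφ0 : ∀ (θ : ℝ → ℝ), tsupport θ ⊆ tsupport φ → ∀ r, r ∉ Ioi (0 : ℝ) → θ r = 0 :=
      fun θ hθ r hr ↦ image_eq_zero_of_notMem_tsupport fun h ↦ hr (hφs (hθ h))
    -- left-hand side in polar coordinates
    have hL : ∫ x, φ ‖x‖ * dV x ∂μ = ∫ r, φ r * B r := by
      rw [integral_eq_integral_Ioi_sphereIntegral μ hi1,
        ← setIntegral_eq_integral_of_forall_compl_eq_zero (μ := (volume : Measure ℝ))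
          (s := Ioi (0 : ℝ)) (f := fun r ↦ φ r * B r)
          (fun r hr ↦ by simp only [hφ0 φ subset_rfl r hr, zero_mul])]
      refine setIntegral_congr_fun measurableSet_Ioi fun r hr ↦ ?_
      simp only [hB]
      rw [sphereIntegral_radial_mul μ φ dV (le_of_lt hr)]
      ring
    -- right-hand side in polar coordinates
    have hR : ∫ x, deriv φ ‖x‖ * ⟪‖x‖⁻¹ • x, V x⟫ ∂μ = ∫ r, deriv φ r * A r := by
      rw [integral_eq_integral_Ioi_sphereIntegral μ hi2,
        ← setIntegral_eq_integral_of_forall_compl_eq_zero (μ := (volume : Measure ℝ))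
          (s := Ioi (0 : ℝ)) (f := fun r ↦ deriv φ r * A r)
          (fun r hr ↦ by simp only [hφ0 (deriv φ) tsupport_deriv_subset r hr, zero_mul])]
      refine setIntegral_congr_fun measurableSet_Ioi fun r hr ↦ ?_
      simp only [hA]
      rw [sphereIntegral_radial_mul μ (deriv φ) _ (le_of_lt hr)]
      ring
    rw [← hL, ← hR]
    exact integral_radial_mul_divergence μ hV hφ hφc hφs
  -- (4) fundamental theorem of calculus and polar coordinates on the shell
  have hderiv : ∀ r ∈ uIcc a b, HasDerivAt A (B r) r := by
    intro r hr
    rw [uIcc_of_le hab] at hr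
    have hr0 : 0 < r := ha.trans_le hr.1
    rw [← hkey hr0]
    exact hAd r hr0
  have hint : IntervalIntegrable B volume a b :=
    (hBc.mono fun r hr ↦ ha.trans_le hr.1).intervalIntegrable_of_Icc hab
  have hftc := intervalIntegral.integral_eq_sub_of_hasDerivAt hderiv hint
  -- the shell integral is `∫_a^b B`
  have hK : IsCompact (closedBall (0 : E) b) := isCompact_closedBall 0 b
  have hsub : {x : E | a < ‖x‖ ∧ ‖x‖ < b} ⊆ closedBall (0 : E) b := fun x hx ↦ by
    rw [mem_closedBall, dist_zero_right]
    exact hx.2.le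
  have hIdV : IntegrableOn dV {x : E | a < ‖x‖ ∧ ‖x‖ < b} μ :=
    (hdVc.continuousOn.integrableOn_compact hK).mono_set hsub
  rw [setIntegral_shell_eq_integral_sphereIntegral μ hIdV ha.le]
  have e1 : ∫ r in Ioo a b, r ^ (n - 1) • sphereIntegral μ dV r = ∫ r in a..b, B r := by
    rw [intervalIntegral.integral_of_le hab, integral_Ioc_eq_integral_Ioo]
    rfl
  rw [e1, hftc]

end Literature.Analysis.FluidPDE

end
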